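import Literature.Probability.Percolation.KestenRelationRussoFromTwoDisplays
import Literature.Probability.Percolation.KestenScalingThetaFromTwoAltDisplays
import Literature.Probability.Percolation.AltFourArmLowerBound
import Literature.Probability.Percolation.KestenRelationRusso
import Literature.Probability.Percolation.KestenRelationRussoProofs
import Literature.Probability.Percolation.NearCriticalRSW
import HarnessLib

/-!
# Nolin's four-arm separation theorem (two named facts) and the assembly of `θ(p) = (p - 1/2)^{5/36 + o(1)}`

Topic `Literature/Probability/Percolation`; family `crit-perc`, statement **crit-perc.S16**
(`Literature.Probability.Percolation.triTheta_exponent`: S. Smirnov, W. Werner, *Math. Res.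
Lett.* 8 (2001), Thm. 1 (i), `θ(p) = (p - 1/2)^{5/36 + o(1)}` as `p ↓ 1/2`).

Fact decomposition (librarian, 2026-08-16). The printed proof of Smirnov–Werner's Thm. 1 (i) is
one sentence: Kesten's scaling relations [Kesten 1987] applied to (1) the one-arm exponent `5/48`
(Lawler–Schramm–Werner 2002, Thm. 1.1) and (2) the polychromatic four-arm exponent `5/4` (SW 2001,
Thm. 4, `j = 4`). The tree mirrors this literally: (1) and (2) are the named facts
`oneArm_exponent` and `fourArm_exponent` (`ArmExponents.lean`), and Kesten's scaling relations
along P. Nolin (EJP 13 (2008), §7) and W. Werner (PCMI 2009, Lecture 6) are PROVED in the tree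
(`KestenScaling*.lean`, `KestenRelationRusso*.lean`, `NearCritical*.lean`, `AltFourArm*.lean`, …)
from exactly TWO displayed statements of Nolin's arm-separation theorem (Nolin 2008, Thm. 11
[arXiv 0711.4948: Thm. 10]) for `j = 4` arms, which no file stated as a named fact so far
(`KestenRelationRussoFromTwoDisplays.lean`, `KestenScalingThetaFromTwoAltDisplays.lean`):

* `Nolin2008_altFourArm_separation` — separation of four ALTERNATING arms (`σ = BWBW`) uniformly
  for `p ∈ [1/2, 1/2 + δ)` below Werner's length `L(p, ε)`:
  `c · π̂^alt_t(n, N) ≤ P_t(sepFourArm n N)` for `n₀ ≤ n`, `2n ≤ N`, `N ≤ L(t, ε)` if `t > 1/2`;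
* `Nolin2008_adjFourArm_landing` — landing of four arms in the ADJACENT arrangement (`σ = BBWW`)
  at `p = 1/2`: `c · P_{1/2}(adjFourArm n N) ≤ P_{1/2}(landedFourAdj n N)` for `n₀ ≤ n`, `2n ≤ N`
  (the separation input of Nolin's colour exchange, §5.1 Prop. 20 [arXiv Prop. 19], which bridges
  Werner's alternating `π̂` to the order-free `π₄ = critFourArmProb` of `fourArm_exponent`;
  the flip itself, `fourArm_flip`, is proved in `FlipFourArm.lean`).

Both are instances of one published theorem; their critical two-arm analogue
`Nolin2008_twoArm_separation` (`ArmSeparation.lean`) is a theorem of the tree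
(`Nolin2008_twoArm_separation_holds`, `ArmSeparationFinalProofs.lean`, 78 files), which fixes the
size of each: elementary (RSW, FKG, Harris chains in U-shaped regions) but long.

* `triTheta_exponent_holds_of` — **the assembly**:
  `oneArm_exponent → fourArm_exponent → Nolin2008_altFourArm_separation →
  Nolin2008_adjFourArm_landing → triTheta_exponent`, by `triTheta_exponent_of_russo`
  (`KestenRelationRusso.lean`) with `Werner2009_lemma62_of_altSeparation_of_landing`
  (`KestenRelationRussoFromTwoDisplays.lean`), `Nolin2008_theta_asymp_of_altSeparation_of_altLB`
  (`KestenScalingThetaFromTwoAltDisplays.lean`) and the theorems `altFourArm_lowerBound`,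
  `BollobasRiordan2006_ch5_lemma7_holds`, `Nolin2008_subcritical_crossing_holds`.

The same two facts discharge, by theorems already in the tree, the named facts
`Werner2009_lemma62` (`Werner2009_lemma62_of_altSeparation_of_landing`), `Nolin2008_theta_asymp`
and `Nolin2008_cor41` (`Nolin2008_theta_asymp_of_altSeparation_of_altLB`,
`Nolin2008_cor41_of_altSeparation_of_altLB`), `Werner2009_oneArm_nearCritical`
(`Werner2009_oneArm_nearCritical_of_altSeparation`), and — with `fourArm_exponent`'s continuum
inputs — `fourArm_exponent` itself (`fourArm_exponent_of_altLimits_of_nearCritical`,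
`ArmExponentsFourArmInputs.lean`).

## References

* P. Nolin, Near-critical percolation in two dimensions, *Electron. J. Probab.* 13 (2008)
  1562–1623, §4.2 Def. 6–8, §4.3 Thm. 11, §5.1 Prop. 20 (arXiv 0711.4948: Def. 6–8, Thm. 10,
  Prop. 19) [Nolin2008].
* H. Kesten, Scaling relations for 2D-percolation, *Comm. Math. Phys.* 109 (1987) 109–156,
  Lemmas 4–6 [KestenScalingCMP1987].
* W. Werner, *Lectures on two-dimensional critical percolation*, IAS/Park City Math. Ser. 16
  (2009), Lecture 6, Prop. 6.1 [WernerPCMI2009].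
* S. Smirnov, W. Werner, Critical exponents for two-dimensional percolation, *Math. Res. Lett.* 8
  (2001) 729–744, Thm. 1 (i) and the paragraph following it [SmirnovWernerMRL2001].
-/

noncomputable section

open MeasureTheory Set
open scoped unitInterval

namespace Literature.Probability.Percolation

open LatticeModels

/-- **Near-critical separation of four alternating arms** (Nolin 2008, Thm. 11 [arXiv 0711.4948:
Thm. 10]: "Fix an integer `j ≥ 1`, some color sequence `σ` and `η₀, η'₀ ∈ (0,1)`. Then
`P̂(Ã̃^{η,I/η',I'}_{j,σ}(n, N)) ≍ P̂(A_{j,σ}(n, N))` uniformly in all landing sequences `I/I'` of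
size `η/η'`, with `η ≥ η₀` and `η' ≥ η'₀`, `p`, `P̂` between `P_p` and `P_{1-p}`, `n ≤ N ≤ L(p)`";
after Kesten 1987, Lemmas 4–6; Werner 2009, Lecture 6, Prop. 6.1), specialised to `j = 4`,
`σ = BWBW` (alternating colours), the fixed landing sides `0, 3` (open) and `1, 4` (closed) of
the hexagons `∂Λ_n`, `∂Λ_N` with fences, i.e. the relaxed well-separated event `sepFourArm n N`
(`ArmSeparationFourArm.lean`), and Werner's length `L(t, ε) = charLengthW ε t` in place of Nolin's
`L(p)` (all these lengths are `≍`, Nolin 2008, §7.1; the statement is quantified over every small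
`ε`). In Lean: for every `ε ∈ (0, ε₁)` there are `n₀`, `δ > 0`, `c > 0` with
`c · π̂^alt_t(n, N) ≤ P_t(sepFourArm n N)` whenever `1/2 ≤ t < 1/2 + δ`, `n₀ ≤ n`, `2n ≤ N`, and
`N ≤ L(t, ε)` if `t > 1/2` (`π̂^alt_t = altFourArmProbAt t`, Werner's alternating four-arm
probability). Only the lower bound `≳` is recorded (the upper bound is trivial for Nolin's event
and not claimed for the relaxed one); densities `t < 1/2` follow by colour duality and are not
needed. This is hypothesis `hsepA` of `KestenRelationRussoFromTwoDisplays.lean`,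
`KestenScalingThetaFromTwoAltDisplays.lean`, `WernerOneArmStabilityFromAltSeparation.lean`,
`AltFourArmStability.lean`. [cite: Nolin2008, Thm. 11, j = 4, σ = BWBW (arXiv 0711.4948: Thm. 10)] [cite: WernerPCMI2009, Lecture 6, Prop. 6.1] -/
def Nolin2008_altFourArm_separation : Prop :=
  ∃ ε₁ > (0 : ℝ), ∀ ⦃ε : ℝ⦄, 0 < ε → ε < ε₁ →
    ∃ n₀ : ℕ, ∃ δ > (0 : ℝ), ∃ c > (0 : ℝ),
      ∀ t : unitInterval, 1 / 2 ≤ (t : ℝ) → (t : ℝ) < 1 / 2 + δ →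
        ∀ n N : ℕ, n₀ ≤ n → 2 * n ≤ N → (1 / 2 < (t : ℝ) → N ≤ charLengthW ε t) →
          c * altFourArmProbAt t n N ≤ (triSitePercolation t).real (sepFourArm n N)

/-- **Landing of four arms in the adjacent arrangement at criticality** (Nolin 2008, Thm. 11
[arXiv 0711.4948: Thm. 10], the same theorem, specialised to `j = 4`, `σ = BBWW`, `p = 1/2`
(where `L(1/2) = ∞`) and external landing only: the two open arms end on the sides `{x₀ = R}`,
`{x₀ + x₁ = R}` of `∂Λ_R` and the two closed arms on `{x₀ = -R}`, `{x₀ + x₁ = -R}`, the event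
`landedFourAdj n N` of `ArmPatternsFourArm.lean`; `adjFourArm n N` is the four-arm event in the
cyclic colour order `BBWW`). In Lean: there are `c > 0` and `n₀` with
`c · P_{1/2}(adjFourArm n N) ≤ P_{1/2}(landedFourAdj n N)` for all `n₀ ≤ n`, `2n ≤ N`. This is
the separation input of Nolin's colour exchange (§5.1, proof of Prop. 20 [arXiv Prop. 19]); the
exchange itself is the theorem `fourArm_flip` (`FlipFourArm.lean`), and
`fourArm_bridge_of_landing` turns this fact into the bridge `c · π₄(n, N) ≤ π̂^alt_{1/2}(n, N)`
between the order-free and the alternating four-arm probabilities. Hypothesis `hLand` of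
`KestenRelationRussoFromTwoDisplays.lean` and `ArmExponentsFourArmInputs.lean`. [cite: Nolin2008, Thm. 11, j = 4, σ = BBWW, p = 1/2 (arXiv 0711.4948: Thm. 10); §5.1, proof of Prop. 20 (arXiv Prop. 19)] -/
def Nolin2008_adjFourArm_landing : Prop :=
  ∃ c : ℝ, 0 < c ∧ ∃ n₀ : ℕ, ∀ n N : ℕ, n₀ ≤ n → 2 * n ≤ N →
    c * (triSitePercolation half).real (adjFourArm n N) ≤
      (triSitePercolation half).real (landedFourAdj n N)

/-- **Assembly of crit-perc.S16 (i), `θ(p) = (p - 1/2)^{5/36 + o(1)}`** (Smirnov–Werner 2001,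
Thm. 1 (i) and its printed proof: "It has been shown by Kesten in [Kpaper] … that all these
results hold provided that" (1) `P[A_R^1] = R^{-5/48 + o(1)}` and (2) `P[A_R^2] = R^{-5/4 + o(1)}`).
IF the one-arm exponent `oneArm_exponent` (1), the four-arm exponent `fourArm_exponent` (2), and
Nolin's arm separation for four arms in its two colour arrangements
(`Nolin2008_altFourArm_separation`, `Nolin2008_adjFourArm_landing`) hold, THEN
`triTheta_exponent`. Proof: `triTheta_exponent_of_russo` with Werner's Lemma 6.2
(`Werner2009_lemma62_of_altSeparation_of_landing`), Nolin's (7.25) with Cor. 41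
(`Nolin2008_theta_asymp_of_altSeparation_of_altLB` and the a priori bound `altFourArm_lowerBound`),
self-duality (`BollobasRiordan2006_ch5_lemma7_holds`) and sub-critical decay
(`Nolin2008_subcritical_crossing_holds`), all theorems of the tree. [cite: SmirnovWernerMRL2001, Thm. 1 (i) and the paragraph following Thm. 1 (arXiv math/0109120, p. 4)] [cite: KestenScalingCMP1987, Thm. 2 and Cor. 2] [cite: Nolin2008, Thm. 11, §7.3 Prop. 34, §7.4 Cor. 41 and (7.25) (arXiv 0711.4948: Thm. 10, Prop. 32, Cor. 39)] -/
theorem triTheta_exponent_holds_of (h₁ : oneArm_exponent) (h₄ : fourArm_exponent)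
    (hsepA : Nolin2008_altFourArm_separation) (hLand : Nolin2008_adjFourArm_landing) :
    triTheta_exponent :=
  triTheta_exponent_of_russo h₁ h₄ BollobasRiordan2006_ch5_lemma7_holds
    Nolin2008_subcritical_crossing_holds
    (Werner2009_lemma62_of_altSeparation_of_landing hsepA hLand)
    (Nolin2008_theta_asymp_of_altSeparation_of_altLB hsepA altFourArm_lowerBound)

end Literature.Probability.Percolation

end
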